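import Literature.Probability.RandomPlanarGeometry.HexSAWStripBridgeKernelCesaro
import Literature.Probability.RandomPlanarGeometry.HexSAWStripIrreducibleBridgeMean
import Literature.Probability.RandomPlanarGeometry.HexSAWStripThresholdPointwise
import Literature.Probability.Process.MatrixRenewalCoefficients
import Literature.Analysis.Complex.PringsheimNonnegativeCoefficients
import HarnessLib

/-!
# The coefficientwise renewal theorem of critical strip bridges: `d_{ab}(m) · y_T^m → ρ u_a ℓ_b / y_T`

Topic `Literature/Probability/RandomPlanarGeometry` (continues `HexSAWStripBridgeKernelResidue.lean` — the rank-one residue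
`(y_T − y) D_{ab}(y) → ρ u_a ℓ_b` —, `HexSAWStripBridgeKernelCesaro.lean` — `D_{ab}(y) = Σ_m d_{ab}(m) y^m`, the Abelian input and the
Cesàro law — and `HexSAWStripIrreducibleBridgeMean.lean` — `I(y)_{ab} = Σ_j m_{ab}(j) y^j` and the finite mean contact number of
critical irreducible bridges; tool: the tree's coefficient renewal theorem for matrix renewal sequences
`Process/MatrixRenewalCoefficients.lean`).  Lane «pcv-sawmu» (CriticalPhenomena venture), a-p2 g19.  Sources of the SETTING:
H. Duminil-Copin, A. Hammond, CMP 324 (2013) §2.2 (bridges, renewal points, irreducible bridges of self-avoiding walk);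
N. R. Beaton, M. Bousquet-Mélou, J. de Gier, H. Duminil-Copin, A. J. Guttmann, CMP 326 (2014), arXiv:1109.0358v5, §3.2 and Corollary 8
(the surface threshold `y_T` of the width-`T` honeycomb strip `S_T`).  Neither states the law below; in print the strip series are
rational and such a statement would come from a Perron–Frobenius analysis of a transfer matrix — not used here.

## What is proved (namespace `Literature.Probability.RandomPlanarGeometry.SAW.HV`, `y_T = stripYT T`, `T ≥ 2`)

* §1 (a tool) uniqueness of the coefficients of a power series with non-negative coefficients from its values on a real interval
  inside the disc of convergence (identity theorem; `private`).
* §2 ★ `hKernel_eq_Iinf_add_sum_mul` — the renewal equation of the generating functions, `D_{ab}(y) = I(y)_{ab} + Σ_c I(y)_{ac} D_{cb}(y)`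
  on `[1, y_T)`; ★★ `hbCoeff_eq_irCoeff_add_sum` — its COEFFICIENTWISE form
  `d_{ab}(m) = m_{ab}(m) + Σ_c Σ_{i+j=m} m_{ac}(i) d_{cb}(j)` (all `m`, `T ≥ 1`).
* §3 `stripRenewalPair T` — the matrix renewal pair `M(j)_{ab} = m_{ab}(j) y_T^j`, `D(m)_{ab} = d_{ab}(m) y_T^m` of the strip, and
  ★★ `stripRenewalPair_critical` — it is CRITICAL in the sense of `RenewalKernelPair.Critical` with Abelian limits
  `L_{ab} = ρ u_a ℓ_b / y_T` (residue theorem + Cesàro file), finite mean (irreducible-bridge mean file) and aperiodicity witnessed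
  by the three-vertex bridge wall → level `2T−2` → wall with exactly one surface contact (`wallReturn_mem_HBab`);
  `stripRenewalPair_critical_of_residue` — the same for ANY positive residue data `R`.
* §4 ★★★ `exists_tendsto_hbCoeff_mul_pow` — THE COEFFICIENTWISE RENEWAL THEOREM OF CRITICAL STRIP BRIDGES: with the positive `u`, `ℓ`,
  `ρ` of the residue theorem, for all levels `a, b`: `d_{ab}(m) · y_T^m ⟶ ρ u_a ℓ_b / y_T` as `m → ∞` — the `x_c`-weighted number of
  standard horizontal bridges of `S_T` between two levels with exactly `m` surface contacts decays EXACTLY like `y_T^{−m}` with an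
  explicit rank-one constant (the Cesàro law of `HexSAWStripBridgeKernelCesaro` upgraded to a pointwise limit);
  `tendsto_hbCoeff_mul_pow_of_residue` — the same with the constant `R_{ab}/y_T` for any given residue data `R`.
* §5 ★★ `exists_tendsto_hbCoeff_ratio`, `exists_tendsto_hbCoeff_exitLaw` — pointwise decoupling of entrance and exit levels;
  ★★ `tendsto_hbCoeff_succ_div` — the ratio limit `d_{ab}(m+1)/d_{ab}(m) → 1/y_T`.

Label: LANE THEOREM (own result of lane «pcv-sawmu», a-p2 g19, 2026-08-25); template: Feller XIII (recurrent events) / Erdős–Feller–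
Pollard / Madras–Slade Theorem 4.2.2 through the tree's matrix version.  NOT claimed: the corresponding statement for the β-walk
coefficients `β_{T,m}` of `B_T(x_c; ·)` (only two-sided bounds are in the tree), `T = 1`, uniformity in `T`, a rate.
-/

noncomputable section

open Finset Filter Topology Matrix Literature.Probability.LatticeModels Literature.Probability.Percolation Literature.Analysis.Matrix
  Literature.Probability.Process

namespace Literature.Probability.RandomPlanarGeometry.SAW

namespace HV

variable {T : ℕ}

/-! ### §1 Tool: coefficients of a non-negative power series are determined by its values on an interval -/

/-- **Uniqueness of coefficients.** Two power series with non-negative real coefficients that converge and agree on a real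
interval `(r₁, r₂)`, `0 ≤ r₁ < r₂`, have the same coefficients (identity theorem for the complexified series on the disc of
radius between the interval and `r₂`). [cite: Titchmarsh1939, §7.21; folklore (identity theorem)] -/
private theorem eq_of_tsum_mul_pow_eq {a b : ℕ → ℝ} (ha : ∀ n, 0 ≤ a n) (hb : ∀ n, 0 ≤ b n) {r₁ r₂ : ℝ} (hr₁ : 0 ≤ r₁)
    (hr : r₁ < r₂) (hsa : ∀ t ∈ Set.Ioo r₁ r₂, Summable fun n => a n * t ^ n)
    (hsb : ∀ t ∈ Set.Ioo r₁ r₂, Summable fun n => b n * t ^ n)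
    (heq : ∀ t ∈ Set.Ioo r₁ r₂, ∑' n, a n * t ^ n = ∑' n, b n * t ^ n) : a = b := by
  set ρ : ℝ := (r₁ + r₂) / 2 with hρ
  set τ : ℝ := (ρ + r₂) / 2 with hτ
  have hρ1 : r₁ < ρ := by rw [hρ]; linarith
  have hρτ : ρ < τ := by rw [hτ]; linarith
  have hτ2 : τ < r₂ := by rw [hτ]; linarith
  have hτ0 : 0 < τ := by linarith
  have hτmem : τ ∈ Set.Ioo r₁ r₂ := ⟨by linarith, hτ2⟩
  set pa : FormalMultilinearSeries ℂ ℂ ℂ := FormalMultilinearSeries.ofScalars ℂ (fun n => (a n : ℂ)) with hpa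
  set pb : FormalMultilinearSeries ℂ ℂ ℂ := FormalMultilinearSeries.ofScalars ℂ (fun n => (b n : ℂ)) with hpb
  have hra : ENNReal.ofReal τ ≤ pa.radius := Literature.Analysis.Complex.ofReal_le_radius_of_summable ha hτ0.le (hsa τ hτmem)
  have hrb : ENNReal.ofReal τ ≤ pb.radius := Literature.Analysis.Complex.ofReal_le_radius_of_summable hb hτ0.le (hsb τ hτmem)
  have hτpos : (0 : ENNReal) < ENNReal.ofReal τ := ENNReal.ofReal_pos.2 hτ0
  have hpa0 : 0 < pa.radius := lt_of_lt_of_le hτpos hra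
  have hpb0 : 0 < pb.radius := lt_of_lt_of_le hτpos hrb
  have hfa := pa.hasFPowerSeriesOnBall hpa0
  have hfb := pb.hasFPowerSeriesOnBall hpb0
  -- the sum functions agree at the real points of `(r₁, ρ)`
  have hagree : ∀ t : ℝ, r₁ < t → t < ρ → pa.sum t = pb.sum t := fun t ht1 ht2 => by
    have ht0 : 0 ≤ t := hr₁.trans ht1.le
    have htmem : t ∈ Set.Ioo r₁ r₂ := ⟨ht1, by linarith⟩
    have htr : ENNReal.ofReal t < ENNReal.ofReal τ := (ENNReal.ofReal_lt_ofReal_iff hτ0).2 (by linarith)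
    have h1 := Literature.Analysis.Complex.hasSum_ofScalars_ofReal_sum (a := a) ht0 (lt_of_lt_of_le htr hra)
    have h2 := Literature.Analysis.Complex.hasSum_ofScalars_ofReal_sum (a := b) ht0 (lt_of_lt_of_le htr hrb)
    have h1' : HasSum (fun n => (a n : ℂ) * (t : ℂ) ^ n) ((∑' n, a n * t ^ n : ℝ) : ℂ) := by
      have := Complex.ofRealCLM.hasSum (hsa t htmem).hasSum
      simpa [Function.comp] using this
    have h2' : HasSum (fun n => (b n : ℂ) * (t : ℂ) ^ n) ((∑' n, b n * t ^ n : ℝ) : ℂ) := by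
      have := Complex.ofRealCLM.hasSum (hsb t htmem).hasSum
      simpa [Function.comp] using this
    rw [h1.unique h1', h2.unique h2', heq t htmem]
  -- identity theorem on the ball of radius `τ`
  set S : Set ℂ := Metric.ball (0 : ℂ) τ with hS
  have hSball : ∀ z ∈ S, z ∈ Metric.eball (0 : ℂ) (ENNReal.ofReal τ) := fun z hz => by
    rw [Metric.mem_eball, edist_zero_right, ← ofReal_norm]
    exact (ENNReal.ofReal_lt_ofReal_iff hτ0).2 (by simpa [hS] using hz)
  have hAa : AnalyticOnNhd ℂ pa.sum S := fun z hz => hfa.analyticAt_of_mem (Metric.eball_subset_eball hra (hSball z hz))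
  have hAb : AnalyticOnNhd ℂ pb.sum S := fun z hz => hfb.analyticAt_of_mem (Metric.eball_subset_eball hrb (hSball z hz))
  have hz₀ : (((r₁ + ρ) / 2 : ℝ) : ℂ) ∈ S := by
    rw [hS, Metric.mem_ball, dist_zero_right, Complex.norm_real, Real.norm_of_nonneg (by linarith)]
    linarith
  have hfreq : ∃ᶠ z in 𝓝[≠] (((r₁ + ρ) / 2 : ℝ) : ℂ), pa.sum z = pb.sum z :=
    Literature.Analysis.Complex.frequently_nhdsWithin_ne_of_forall_Ioo (η := (ρ - r₁) / 2) (by linarith)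
      fun t ht1 ht2 => hagree t (by linarith) (by linarith)
  have hEq : Set.EqOn pa.sum pb.sum S :=
    hAa.eqOn_of_preconnected_of_frequently_eq hAb (convex_ball _ _).isPreconnected hz₀ hfreq
  -- same power series at `0`, hence the same coefficients
  have hev : pa.sum =ᶠ[𝓝 0] pb.sum := Filter.eventuallyEq_of_mem (Metric.ball_mem_nhds _ hτ0) hEq
  have hpeq : pa = pb := (hfa.hasFPowerSeriesAt.congr hev).eq_formalMultilinearSeries hfb.hasFPowerSeriesAt |>.symm |>.symm
  funext n
  have h := congr_arg (fun p : FormalMultilinearSeries ℂ ℂ ℂ => p n fun _ => (1 : ℂ)) hpeq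
  simp only [hpa, hpb, Literature.Analysis.Complex.ofScalars_ofReal_apply, one_pow, mul_one] at h
  exact_mod_cast h

/-- Cauchy product with powers (plumbing): `Σ_m (Σ_{i+j=m} f_i g_j) s^m = (Σ f_m s^m)(Σ g_m s^m)` for non-negative summable data.
[cite: Feller1968, XIII.3; lane plumbing (Mathlib `Summable.tsum_mul_tsum_eq_tsum_sum_antidiagonal`)] -/
private theorem tsum_antidiagonal_mul_pow' {f g : ℕ → ℝ} (hf : ∀ m, 0 ≤ f m) (hg : ∀ m, 0 ≤ g m) {s : ℝ} (hs : 0 ≤ s)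
    (hfs : Summable fun m => f m * s ^ m) (hgs : Summable fun m => g m * s ^ m) :
    (Summable fun m => (∑ p ∈ antidiagonal m, f p.1 * g p.2) * s ^ m) ∧
      ∑' m, (∑ p ∈ antidiagonal m, f p.1 * g p.2) * s ^ m = (∑' m, f m * s ^ m) * ∑' m, g m * s ^ m := by
  have hfg : Summable fun x : ℕ × ℕ => (fun m => f m * s ^ m) x.1 * (fun m => g m * s ^ m) x.2 :=
    hfs.mul_of_nonneg hgs (fun m => mul_nonneg (hf m) (pow_nonneg hs m)) (fun m => mul_nonneg (hg m) (pow_nonneg hs m))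
  have h1 := summable_sum_mul_antidiagonal_of_summable_mul (f := fun m => f m * s ^ m) (g := fun m => g m * s ^ m) hfg
  have h2 := hfs.tsum_mul_tsum_eq_tsum_sum_antidiagonal hgs hfg
  have hterm : ∀ m, ∑ p ∈ antidiagonal m, f p.1 * s ^ p.1 * (g p.2 * s ^ p.2) =
      (∑ p ∈ antidiagonal m, f p.1 * g p.2) * s ^ m := fun m => by
    rw [sum_mul]
    refine sum_congr rfl fun p hp => ?_
    have hp' : p.1 + p.2 = m := HasAntidiagonal.mem_antidiagonal.mp hp
    rw [← hp', pow_add]; ring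
  simp only [hterm] at h1 h2
  exact ⟨h1, h2.symm⟩

/-! ### §2 The renewal equation of the horizontal-bridge generating functions and of their contact coefficients -/

/-- ★ **`D = I + I·D`**: for `y ∈ [1, y_T)` and all levels, `D_{ab}(y) = I(y)_{ab} + Σ_c I(y)_{ac} · D_{cb}(y)`
(from `D = Σ_{k≥1} I^k`). [cite: DuminilCopinHammond2013, §2.2 (decomposition at the first renewal point); Feller1968, XIII.3; lane] -/
theorem hKernel_eq_Iinf_add_sum_mul (hT : 1 ≤ T) {y : ℝ} (hy : y ∈ Set.Ico 1 (stripYT T)) (a b : Fin (2 * T)) :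
    hKernel T a b y = Iinf T y a b + ∑ c, Iinf T y a c * hKernel T c b y := by
  have hs1 : ∀ c, Summable fun k => (Iinf T y ^ (k + 1)) c b := fun c =>
    (summable_nat_add_iff (f := fun j => (Iinf T y ^ j) c b) 1).2 (summable_pow_Iinf hT hy c b)
  rw [hKernel_eq_tsum_succ hT hy a b, (hs1 a).tsum_eq_zero_add, zero_add, pow_one]
  congr 1
  have h1 : ∀ c, Iinf T y a c * hKernel T c b y = ∑' k, Iinf T y a c * (Iinf T y ^ (k + 1)) c b := fun c => by
    rw [hKernel_eq_tsum_succ hT hy c b, tsum_mul_left]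
  simp_rw [h1]
  rw [← Summable.tsum_finsetSum (fun c _ => (hs1 c).mul_left _)]
  refine tsum_congr fun k => ?_
  rw [pow_succ' (Iinf T y) (k + 1), Matrix.mul_apply]

/-- ★★ **The renewal equation of the contact coefficients**: for `T ≥ 1`, all levels `a, b` and all `m`,
`d_{ab}(m) = m_{ab}(m) + Σ_c Σ_{i+j=m} m_{ac}(i) · d_{cb}(j)` — a standard horizontal bridge with `m` surface contacts is irreducible,
or splits at its first renewal point into an irreducible bridge with `i` contacts and a bridge with `m − i` contacts.  (Obtained from
`D = I + I·D` by uniqueness of power-series coefficients.) [cite: DuminilCopinHammond2013, §2.2; Feller1968, XIII.3; lane «pcv-sawmu», a-p2 g19] -/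
theorem hbCoeff_eq_irCoeff_add_sum (hT : 1 ≤ T) (a b : Fin (2 * T)) (m : ℕ) :
    hbCoeff T m a b = irCoeff T m a b + ∑ c, ∑ p ∈ antidiagonal m, irCoeff T p.1 a c * hbCoeff T p.2 c b := by
  have hyT := one_lt_stripYT hT
  -- both sides are coefficient sequences of power series that agree on `(1, y_T)`
  have hR : ∀ m, 0 ≤ irCoeff T m a b + ∑ c, ∑ p ∈ antidiagonal m, irCoeff T p.1 a c * hbCoeff T p.2 c b := fun m =>
    add_nonneg (irCoeff_nonneg hT m a b) (sum_nonneg fun c _ => sum_nonneg fun p _ =>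
      mul_nonneg (irCoeff_nonneg hT _ a c) (hbCoeff_nonneg hT _ c b))
  have key : ∀ y ∈ Set.Ioo (1 : ℝ) (stripYT T),
      (Summable fun m => (irCoeff T m a b + ∑ c, ∑ p ∈ antidiagonal m, irCoeff T p.1 a c * hbCoeff T p.2 c b) * y ^ m) ∧
      ∑' m, (irCoeff T m a b + ∑ c, ∑ p ∈ antidiagonal m, irCoeff T p.1 a c * hbCoeff T p.2 c b) * y ^ m =
        ∑' m, hbCoeff T m a b * y ^ m := by
    intro y hy
    have hy' : y ∈ Set.Ico (1 : ℝ) (stripYT T) := ⟨hy.1.le, hy.2⟩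
    have hy0 : 0 ≤ y := zero_le_one.trans hy.1.le
    have hI := fun c => summable_irCoeff_mul_pow hT hy' a c
    have hD := fun c => summable_hbCoeff_mul_pow hT hy' c b
    have hC := fun c => tsum_antidiagonal_mul_pow' (fun m => irCoeff_nonneg hT m a c) (fun m => hbCoeff_nonneg hT m c b) hy0 (hI c) (hD c)
    have hsumC : Summable fun m => (∑ c, ∑ p ∈ antidiagonal m, irCoeff T p.1 a c * hbCoeff T p.2 c b) * y ^ m := by
      have : (fun m => (∑ c, ∑ p ∈ antidiagonal m, irCoeff T p.1 a c * hbCoeff T p.2 c b) * y ^ m) =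
          fun m => ∑ c, (∑ p ∈ antidiagonal m, irCoeff T p.1 a c * hbCoeff T p.2 c b) * y ^ m := by
        funext m; rw [sum_mul]
      rw [this]
      exact summable_sum fun c _ => (hC c).1
    refine ⟨?_, ?_⟩
    · simp_rw [add_mul]; exact (hI b).add hsumC
    · have hfun : (fun m => (∑ c, ∑ p ∈ antidiagonal m, irCoeff T p.1 a c * hbCoeff T p.2 c b) * y ^ m) =
          fun m => ∑ c, (∑ p ∈ antidiagonal m, irCoeff T p.1 a c * hbCoeff T p.2 c b) * y ^ m := by
        funext m; rw [sum_mul]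
      simp_rw [add_mul]
      rw [(hI b).tsum_add hsumC, ← Iinf_eq_tsum_irCoeff hT hy' a b, ← hKernel_eq_tsum_hbCoeff hT hy' a b,
        hKernel_eq_Iinf_add_sum_mul hT hy' a b]
      congr 1
      rw [hfun, Summable.tsum_finsetSum (fun c _ => (hC c).1)]
      refine sum_congr rfl fun c _ => ?_
      rw [(hC c).2, ← Iinf_eq_tsum_irCoeff hT hy' a c, ← hKernel_eq_tsum_hbCoeff hT hy' c b]
  have h := eq_of_tsum_mul_pow_eq (hbCoeff_nonneg hT · a b) hR zero_le_one hyT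
    (fun y hy => summable_hbCoeff_mul_pow hT ⟨hy.1.le, hy.2⟩ a b) (fun y hy => (key y hy).1) (fun y hy => ((key y hy).2).symm)
  exact congr_fun h m

/-! ### §3 The strip's matrix renewal pair at `y_T` and its criticality -/

/-- The MATRIX RENEWAL PAIR of the strip at the threshold: `M(j)_{ab} = m_{ab}(j) y_T^j` (irreducible bridges with `j` contacts),
`D(m)_{ab} = d_{ab}(m) y_T^m` (all bridges with `m` contacts). [cite: DuminilCopinHammond2013, §2.2; lane] -/
def stripRenewalPair (hT : 1 ≤ T) : RenewalKernelPair (Fin (2 * T)) where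
  M j := Matrix.of fun a b => irCoeff T j a b * stripYT T ^ j
  D m := Matrix.of fun a b => hbCoeff T m a b * stripYT T ^ m
  M_nonneg j a b := by
    rw [Matrix.of_apply]; exact mul_nonneg (irCoeff_nonneg hT j a b) (pow_nonneg (stripYT_pos hT).le j)
  D_nonneg m a b := by
    rw [Matrix.of_apply]; exact mul_nonneg (hbCoeff_nonneg hT m a b) (pow_nonneg (stripYT_pos hT).le m)
  ren m := by
    ext a b
    simp only [Matrix.add_apply, Matrix.sum_apply, Matrix.mul_apply, Matrix.of_apply]
    rw [hbCoeff_eq_irCoeff_add_sum hT a b m, add_mul]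
    simp only [Finset.sum_mul]
    rw [Finset.sum_comm]
    congr 1
    refine sum_congr rfl fun p hp => sum_congr rfl fun c _ => ?_
    have hp' : p.1 + p.2 = m := HasAntidiagonal.mem_antidiagonal.mp hp
    rw [← hp', pow_add]; ring

/-- The three-vertex WALL RETURN `(0,T−1,↓) → (1,T−1,↑) → (1,T−1,↓)`: a standard horizontal bridge of `S_T` from the wall level
`2T−1` back to it with exactly one surface contact off its start, of weight `x_c²·y` — the aperiodicity witness.
[cite: BeatonBousquetMelouDeGierDuminilCopinGuttmann2014, §4 (a surface contact weighs y); DuminilCopinHammond2013, §2.2; lane] -/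
theorem wallReturn_mem_HBab (hT : 1 ≤ T) {N : ℕ} (hN : 2 ≤ N) :
    [((0 : ℤ), ((T : ℤ) - 1), true), ((1 : ℤ), ((T : ℤ) - 1), false), ((1 : ℤ), ((T : ℤ) - 1), true)] ∈
        (HBab T N (2 * (T : ℤ) - 1) (2 * (T : ℤ) - 1)).filter (fun l => topCnt T l.tail = 1) := by
  obtain ⟨l1, l2, x1, x2⟩ := lev_explicit 0 ((T : ℤ) - 1)
  obtain ⟨l1', l2', x1', x2'⟩ := lev_explicit 1 ((T : ℤ) - 1)
  set u : HV := ((0 : ℤ), ((T : ℤ) - 1), true)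
  set v : HV := ((1 : ℤ), ((T : ℤ) - 1), false)
  set w : HV := ((1 : ℤ), ((T : ℤ) - 1), true)
  have huv : hvGraph.Adj u v := by simp [u, v, hvGraph_adj, AdjRel]
  have hvw : hvGraph.Adj v w := by simp [v, w, hvGraph_adj, AdjRel]
  have hne1 : u ≠ v := huv.ne
  have hne2 : v ≠ w := hvw.ne
  have hne3 : u ≠ w := by simp [u, w]
  rw [mem_filter, HBab, mem_filter, mem_hBridgesN_iff]
  refine ⟨⟨⟨?_, ?_, ?_, ⟨u, rfl, rfl⟩, ?_, ?_⟩, by simp, ?_, ?_⟩, ?_⟩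
  · simp [huv, hvw]
  · simp [hne1, hne2, hne3]
  · simp only [List.length_cons, List.length_nil]; omega
  · intro z hz
    simp only [List.mem_cons, List.not_mem_nil, or_false] at hz
    rcases hz with rfl | rfl | rfl
    · rw [l2]; omega
    · rw [l1']; omega
    · rw [l2']; omega
  · refine ⟨by simp, fun z hz => ?_⟩
    simp only [List.tail_cons, List.mem_cons, List.not_mem_nil, or_false] at hz
    simp only [List.head_cons, List.getLast_cons_cons, List.getLast_singleton]
    rcases hz with rfl | rfl
    · rw [x2, x1', x2']; omega
    · rw [x2, x2']; omega
  · simp only [hdLev, List.head?_cons, Option.getD_some]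
    rw [l2]; ring
  · simp only [ltLev, List.getLast?_cons_cons, List.getLast?_singleton, Option.getD_some]
    rw [l2']; ring
  · simp only [List.tail_cons]
    rw [topCnt_cons, topCnt_singleton, l1', l2']
    rw [if_neg (by omega), if_pos (by ring)]

/-- ★ Aperiodicity: `d_{2T−1,2T−1}(1) > 0` (`T ≥ 1`). [cite: DuminilCopinHammond2013, §2.2; lane] -/
theorem hbCoeff_one_wall_pos (hT : 1 ≤ T) :
    0 < hbCoeff T 1 ⟨2 * T - 1, by omega⟩ ⟨2 * T - 1, by omega⟩ := by
  have hx := hexCriticalFugacity_pos_lt_one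
  have hmem := wallReturn_mem_HBab hT (N := 2) le_rfl
  have hcast : (((⟨2 * T - 1, by omega⟩ : Fin (2 * T)) : ℕ) : ℤ) = 2 * (T : ℤ) - 1 := by
    push_cast [Nat.cast_sub (show 1 ≤ 2 * T by omega)]; ring
  refine lt_of_lt_of_le ?_ (hbCoeffN_le_hbCoeff hT 2 1 _ _)
  rw [hbCoeffN, hcast]
  refine lt_of_lt_of_le (pow_pos hx.1 2) ?_
  have := single_le_sum (f := fun l : List HV => hexCriticalFugacity ^ (l.length - 1))
    (fun l _ => pow_nonneg hx.1.le _) hmem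
  simpa using this

/-- ★★ **The strip's matrix renewal pair is CRITICAL for any residue data** (`T ≥ 2`): if `(y_T − y)·D_{ab}(y) → R_{ab} > 0` as
`y ↑ y_T` for all levels (the residue theorem provides `R_{ab} = ρ u_a ℓ_b`), then the hypotheses of `RenewalKernelPair.Critical` hold
with `L_{ab} = R_{ab} / y_T` — summability on `[0,1)` and the Abelian limits from `HexSAWStripBridgeKernelCesaro`, the finite mean from
`HexSAWStripIrreducibleBridgeMean`, aperiodicity from the wall return.
[cite: DuminilCopinHammond2013, §2.2; BeatonBousquetMelouDeGierDuminilCopinGuttmann2014, Corollary 8; Seneta1973, Chapter 6; lane «pcv-sawmu», a-p2 g19] -/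
theorem stripRenewalPair_critical_of_residue (hT : 2 ≤ T) {R : Fin (2 * T) → Fin (2 * T) → ℝ} (hR : ∀ a b, 0 < R a b)
    (hD : ∀ a b, Tendsto (fun y => (stripYT T - y) * hKernel T a b y) (𝓝[<] stripYT T) (𝓝 (R a b))) :
    (stripRenewalPair (T := T) (by omega)).Critical (fun a b => R a b / stripYT T) := by
  have hT1 : 1 ≤ T := by omega
  have hyT0 : 0 < stripYT T := stripYT_pos hT1
  obtain ⟨K, hK⟩ := exists_tsum_mul_irCoeff_mul_pow_le hT
  refine ⟨?_, ?_, ?_, ?_, ?_⟩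
  · -- summability on `[0,1)`
    intro a b s hs0 hs1
    simpa [stripRenewalPair, mul_assoc] using summable_hbCoeff_mul_pow_stripYT_mul_pow hT1 a b hs0 hs1
  · -- Abelian limits
    intro a b
    have h := tendsto_one_sub_mul_tsum_of_residue hT1 a b (hD a b)
    refine h.congr fun s => ?_
    simp [stripRenewalPair, Real.rpow_one, mul_assoc]
  · intro a b; exact div_pos (hR a b) hyT0
  · -- finite mean
    intro a b
    have h := (hK a b).1.mul_right (stripYT T)
    refine h.congr fun j => ?_
    simp only [stripRenewalPair, Matrix.of_apply]
    rcases Nat.eq_zero_or_pos j with rfl | hj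
    · simp
    · rw [show stripYT T ^ j = stripYT T ^ (j - 1) * stripYT T by rw [← pow_succ]; congr 1; omega]; ring
  · -- aperiodicity at the wall: `1 ∈ {m : D(m)_{oo} > 0}`
    refine ⟨⟨2 * T - 1, by omega⟩, Nat.dvd_one.mp (Nat.setGcd_dvd_of_mem ?_)⟩
    show 0 < (stripRenewalPair (T := T) (by omega)).D 1 ⟨2 * T - 1, by omega⟩ ⟨2 * T - 1, by omega⟩
    simp only [stripRenewalPair, Matrix.of_apply, pow_one]
    exact mul_pos (hbCoeff_one_wall_pos hT1) hyT0

/-- ★★ **The strip's matrix renewal pair is CRITICAL** (`T ≥ 2`): with the positive `u`, `ℓ`, `ρ` of the residue theorem, the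
hypotheses of `RenewalKernelPair.Critical` hold with `L_{ab} = ρ u_a ℓ_b / y_T`.
[cite: DuminilCopinHammond2013, §2.2; BeatonBousquetMelouDeGierDuminilCopinGuttmann2014, Corollary 8; Seneta1973, Chapter 6; lane «pcv-sawmu», a-p2 g19] -/
theorem stripRenewalPair_critical (hT : 2 ≤ T) :
    ∃ (u ℓ : Fin (2 * T) → ℝ) (ρ : ℝ), (∀ a, 0 < u a) ∧ (∀ b, 0 < ℓ b) ∧ 0 < ρ ∧
      (stripRenewalPair (T := T) (by omega)).Critical (fun a b => ρ * (u a * ℓ b) / stripYT T) := by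
  obtain ⟨IT, u, ℓ, ρ, -, hu0, hℓ0, -, -, hρ, hD⟩ := exists_tendsto_hKernel_residue hT
  exact ⟨u, ℓ, ρ, hu0, hℓ0, hρ, stripRenewalPair_critical_of_residue hT (fun a b => mul_pos hρ (mul_pos (hu0 a) (hℓ0 b))) hD⟩

/-! ### §4 The theorem -/

/-- ★★★ **THE COEFFICIENTWISE RENEWAL THEOREM OF CRITICAL STRIP BRIDGES** (`T ≥ 2`).  There are positive level vectors `u`, `ℓ` and
`ρ > 0` (those of the residue theorem `exists_tendsto_hKernel_residue`: `I_T u = u`, `ℓ I_T = ℓ`) such that for ALL levels `a, b`: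
`d_{ab}(m) · y_T^m ⟶ ρ · u_a ℓ_b / y_T` as `m → ∞`, where `d_{ab}(m)` is the `x_c`-weighted number of standard horizontal bridges
of the honeycomb strip `S_T` from level `a` to level `b` with exactly `m` surface contacts off the start vertex and `y_T` is the
surface threshold of the strip.  Equivalently: the number of critical strip bridges with `m` contacts decays exactly like `y_T^{−m}`,
with a RANK-ONE constant — the entrance and exit levels decouple in the limit.  (Matrix renewal theorem of
`Process/MatrixRenewalCoefficients` applied to `stripRenewalPair_critical`.) [cite: Feller1968, XIII.3–4, XIII.11; MadrasSlade1993, Theorem 4.2.2 (b); DuminilCopinHammond2013, §2.2; BeatonBousquetMelouDeGierDuminilCopinGuttmann2014, Corollary 8 (arXiv v5 p. 12); lane «pcv-sawmu», a-p2 g19 — own result] -/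
theorem exists_tendsto_hbCoeff_mul_pow (hT : 2 ≤ T) :
    ∃ (u ℓ : Fin (2 * T) → ℝ) (ρ : ℝ), (∀ a, 0 < u a) ∧ (∀ b, 0 < ℓ b) ∧ 0 < ρ ∧
      ∀ a b, Tendsto (fun m : ℕ => hbCoeff T m a b * stripYT T ^ m) atTop (𝓝 (ρ * (u a * ℓ b) / stripYT T)) := by
  obtain ⟨u, ℓ, ρ, hu0, hℓ0, hρ, hcrit⟩ := stripRenewalPair_critical hT
  refine ⟨u, ℓ, ρ, hu0, hℓ0, hρ, fun a b => ?_⟩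
  have h := RenewalKernelPair.tendsto_coeff _ hcrit a b
  simpa [stripRenewalPair] using h

/-- ★★★ The coefficientwise renewal theorem FOR GIVEN RESIDUE DATA (`T ≥ 2`): if `(y_T − y)·D_{ab}(y) → R_{ab} > 0` for all levels,
then `d_{ab}(m) · y_T^m → R_{ab} / y_T` — the pointwise constant IS the residue (useful downstream: any identification of the residue
constants transfers to the coefficients). [cite: Feller1968, XIII.11; MadrasSlade1993, Theorem 4.2.2 (b); DuminilCopinHammond2013, §2.2; lane «pcv-sawmu», a-p2 g19 — own result] -/
theorem tendsto_hbCoeff_mul_pow_of_residue (hT : 2 ≤ T) {R : Fin (2 * T) → Fin (2 * T) → ℝ} (hR : ∀ a b, 0 < R a b)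
    (hD : ∀ a b, Tendsto (fun y => (stripYT T - y) * hKernel T a b y) (𝓝[<] stripYT T) (𝓝 (R a b))) (a b : Fin (2 * T)) :
    Tendsto (fun m : ℕ => hbCoeff T m a b * stripYT T ^ m) atTop (𝓝 (R a b / stripYT T)) := by
  have h := RenewalKernelPair.tendsto_coeff _ (stripRenewalPair_critical_of_residue hT hR hD) a b
  simpa [stripRenewalPair] using h

/-! ### §5 Corollaries: the entrance and exit levels of a long critical bridge decouple -/

/-- ★★ **Pointwise ratio law**: for all levels `a b c d`, `d_{ab}(m) / d_{cd}(m) → (u_a ℓ_b)/(u_c ℓ_d)` as `m → ∞` (`T ≥ 2`) — among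
the critical strip bridges with exactly `m` surface contacts, entrance and exit levels decouple in the limit (the pointwise version
of `exists_tendsto_hKernel_ratio`). [cite: DuminilCopinHammond2013, §2.2; lane «pcv-sawmu», a-p2 g19 — own result] -/
theorem exists_tendsto_hbCoeff_ratio (hT : 2 ≤ T) :
    ∃ (u ℓ : Fin (2 * T) → ℝ), (∀ a, 0 < u a) ∧ (∀ b, 0 < ℓ b) ∧
      ∀ a b c d, Tendsto (fun m : ℕ => hbCoeff T m a b / hbCoeff T m c d) atTop (𝓝 (u a * ℓ b / (u c * ℓ d))) := by
  have hT1 : 1 ≤ T := by omega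
  have hyT0 : 0 < stripYT T := stripYT_pos hT1
  obtain ⟨u, ℓ, ρ, hu0, hℓ0, hρ, h⟩ := exists_tendsto_hbCoeff_mul_pow hT
  refine ⟨u, ℓ, hu0, hℓ0, fun a b c d => ?_⟩
  have hcd : ρ * (u c * ℓ d) / stripYT T ≠ 0 := (div_pos (mul_pos hρ (mul_pos (hu0 c) (hℓ0 d))) hyT0).ne'
  have hlim := (h a b).div (h c d) hcd
  have heq : ρ * (u a * ℓ b) / stripYT T / (ρ * (u c * ℓ d) / stripYT T) = u a * ℓ b / (u c * ℓ d) := by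
    field_simp
  rw [heq] at hlim
  exact hlim.congr fun m => by rw [Pi.div_apply, mul_div_mul_right _ _ (pow_ne_zero m hyT0.ne')]

/-- ★★ **Pointwise exit law**: for all levels `a, b`, `d_{ab}(m) / Σ_{b'} d_{ab'}(m) → ℓ_b / Σ_{b'} ℓ_{b'}` as `m → ∞` (`T ≥ 2`) — the
exit level of a critical strip bridge with exactly `m` surface contacts has a limiting law, independent of the entrance level (the
pointwise version of `exists_tendsto_exitLaw`). [cite: DuminilCopinHammond2013, §2.2; lane «pcv-sawmu», a-p2 g19 — own result] -/
theorem exists_tendsto_hbCoeff_exitLaw (hT : 2 ≤ T) :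
    ∃ ℓ : Fin (2 * T) → ℝ, (∀ b, 0 < ℓ b) ∧
      ∀ a b, Tendsto (fun m : ℕ => hbCoeff T m a b / ∑ b', hbCoeff T m a b') atTop (𝓝 (ℓ b / ∑ b', ℓ b')) := by
  have hT1 : 1 ≤ T := by omega
  have hyT0 : 0 < stripYT T := stripYT_pos hT1
  haveI : Nonempty (Fin (2 * T)) := ⟨⟨0, by omega⟩⟩
  obtain ⟨u, ℓ, ρ, hu0, hℓ0, hρ, h⟩ := exists_tendsto_hbCoeff_mul_pow hT
  refine ⟨ℓ, hℓ0, fun a b => ?_⟩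
  have hℓs : 0 < ∑ b', ℓ b' := sum_pos (fun b' _ => hℓ0 b') univ_nonempty
  have hsum : Tendsto (fun m : ℕ => ∑ b', hbCoeff T m a b' * stripYT T ^ m) atTop (𝓝 (∑ b', ρ * (u a * ℓ b') / stripYT T)) :=
    tendsto_finsetSum _ fun b' _ => h a b'
  have hne : ∑ b', ρ * (u a * ℓ b') / stripYT T ≠ 0 := by
    rw [← sum_div, ← mul_sum, ← mul_sum]
    exact (div_pos (mul_pos hρ (mul_pos (hu0 a) hℓs)) hyT0).ne'
  have hlim := (h a b).div hsum hne
  have heq : ρ * (u a * ℓ b) / stripYT T / ∑ b', ρ * (u a * ℓ b') / stripYT T = ℓ b / ∑ b', ℓ b' := by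
    rw [← sum_div, ← mul_sum, ← mul_sum]
    have hua : u a ≠ 0 := (hu0 a).ne'
    field_simp
  rw [heq] at hlim
  exact hlim.congr fun m => by rw [Pi.div_apply, ← sum_mul, mul_div_mul_right _ _ (pow_ne_zero m hyT0.ne')]

/-- ★★ **Ratio limit theorem for the contact count**: for all levels `a, b`, `d_{ab}(m+1) / d_{ab}(m) → 1/y_T` as `m → ∞` (`T ≥ 2`)
— one more surface contact costs exactly a factor `y_T` in the number of critical strip bridges, asymptotically (the contact-count
analogue of a Kesten-type ratio limit, here with the exact constant). [cite: BeatonBousquetMelouDeGierDuminilCopinGuttmann2014, Corollary 8 (y_T); DuminilCopinHammond2013, §2.2; lane «pcv-sawmu», a-p2 g19 — own result] -/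
theorem tendsto_hbCoeff_succ_div (hT : 2 ≤ T) (a b : Fin (2 * T)) :
    Tendsto (fun m : ℕ => hbCoeff T (m + 1) a b / hbCoeff T m a b) atTop (𝓝 (1 / stripYT T)) := by
  have hT1 : 1 ≤ T := by omega
  have hyT0 : 0 < stripYT T := stripYT_pos hT1
  obtain ⟨u, ℓ, ρ, hu0, hℓ0, hρ, h⟩ := exists_tendsto_hbCoeff_mul_pow hT
  have hL : ρ * (u a * ℓ b) / stripYT T ≠ 0 := (div_pos (mul_pos hρ (mul_pos (hu0 a) (hℓ0 b))) hyT0).ne'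
  have hsucc : Tendsto (fun m : ℕ => hbCoeff T (m + 1) a b * stripYT T ^ (m + 1)) atTop (𝓝 (ρ * (u a * ℓ b) / stripYT T)) :=
    (h a b).comp (tendsto_add_atTop_nat 1)
  have hlim := (hsucc.div (h a b) hL).div_const (stripYT T)
  rw [div_self hL] at hlim
  refine hlim.congr fun m => ?_
  rw [Pi.div_apply, pow_succ, ← mul_assoc, mul_right_comm, mul_div_mul_right _ _ (pow_ne_zero m hyT0.ne'), div_div,
    mul_div_mul_right _ _ hyT0.ne']

end HV

end Literature.Probability.RandomPlanarGeometry.SAW
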